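import Literature.NumberTheory.QuadraticFields.RingClassGroupTower
import HarnessLib

/-!
# The kernel of `I_K(ℓ)/P_{K,ℤ}(ℓ) → I_K(1)/P_{K,ℤ}(1)` at an inert prime for ANY imaginary quadratic `K`:
# `#G_ℓ ∣ ℓ² − 1` and `#G_ℓ · #𝓞_K^× = (ℓ + 1) · #𝒪_ℓ^×` (the unit index, Cox Thm. 7.24 at `f = ℓ`)

Topic `NumberTheory/QuadraticFields`, namespace `Literature.NumberTheory.QuadraticFields.RingClass` (sequel to
`RingClassGroupTower.lean`, whose `card_ker_restrict` gives `#ker = ℓ + 1` ONLY under `2 ≤ m ∨ #𝓞 Kˣ = 2`, i.e. for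
`m = 1` only when `d_K < −4`: «for `m = 1` and `d_K ∈ {−3, −4}` the order is `(ℓ+1)/3`, `(ℓ+1)/2` instead (not
covered, as in the source)»).  THEOREMS ONLY (no definition, no named fact, no instance, no `sorry`).

THE PRINT.  Cox [Cox2013] §7.D Thm. 7.24 (PDF p. 146): «`h(𝒪) = h(𝒪_K) f / [𝒪_K^× : 𝒪^×] · ∏_{p ∣ f} (1 − (d_K/p) 1/p)`»,
proved from the exact sequence (7.27) `1 → (ℤ/f)^× → 𝒪_K^×·(ℤ/f)^×-part … (𝒪_K/f)^× → I_K(f)/P_{K,ℤ}(f) → C(𝒪_K) → 1`;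
at `f = ℓ` inert (`(d_K/ℓ) = −1`): `[K[ℓ] : K[1]] = h(𝒪_ℓ)/h_K = (ℓ + 1)/[𝒪_K^× : 𝒪_ℓ^×]`.  Gross [GrossLMS1991] §3
(PDF p. 217 l. 1–3): «`G_ℓ ≃ F_λ^×/F_ℓ^×` … of order `ℓ + 1`» under his standing `D ≠ 3, 4` (§1, p. 212).  The tree's
`RingClassNumber.card_ringClassGroup_mul` IS the counting identity of (7.27) at every `f`; this file reads it at
`f = ℓ · 1` against the change-of-conductor map `restrict : I_K(ℓ)/P_{K,ℤ}(ℓ) → I_K(1)/P_{K,ℤ}(1)` (onto at an inert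
prime, `restrict_surjective_of_isPrime_span`; `I_K(1)/P_{K,ℤ}(1) ↪ Cl(𝓞 K)`, `toClassGroup_injective_one`).

* `card_ker_restrict_dvd_sq_sub_one` — **`#ker (I_K(ℓm)/P_{K,ℤ}(ℓm) → I_K(m)/P_{K,ℤ}(m)) ∣ ℓ² − 1`** for ANY quadratic
  `K`, `(ℓ)` prime, `gcd(ℓ, m) = 1` (the kernel is a quotient of `F_λ^×`, `ker_restrict_eq_range`).
* `card_ker_restrict_mul_card_units_eq` — **`#ker (I_K(ℓ)/P_{K,ℤ}(ℓ) → I_K(1)/P_{K,ℤ}(1)) · #𝓞_K^× = (ℓ + 1) · #𝒪_ℓ^×`**,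
  `𝒪_ℓ^× = {ε ∈ 𝓞_K^× : ε ≡ n (mod ℓ), n ∈ ℤ}` (the units of the order of conductor `ℓ`), for any quadratic `K`
  (both sides `0` for a real one); `succ_dvd_card_ker_restrict_mul_card_units` — hence **`ℓ + 1 ∣ #ker · #𝓞_K^×`**.

USE (cell `pub/bsd-print-x9`, G87 = Howard 2004 Thm. 1.6.1, REF-167 ruling (i) «prove degree (ℓ+1)/u_K + p-Sylow under
p ∤ u_K»): Howard's Prop. 1.1.9 at an inert Kolyvagin prime needs only `#G_ℓ ∣ q_λ − 1 = ℓ² − 1` and `#G_ℓ · T = 0` for a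
`p`-primary `T` killed by `ℓ + 1`; the second follows from `ℓ + 1 ∣ #G_ℓ · #𝓞_K^×` as soon as `p ∤ #𝓞_K^×` — replacing the
standing `d_K < −4` by Howard's exact obstruction (failing only at `(p, d_K) = (3, −3)`).  Seat `bsd-line-x9-p1-w3` g15.

References: [Cox2013] §7.D Thm. 7.24, (7.25)–(7.27), Exercise 7.30; [GrossLMS1991] §1 (PDF p. 212), §3 (PDF p. 216–217).

Mathlib / tree search: tree `RingClass.restrict`, `ker_restrict_eq_range`, `restrict_surjective_of_isPrime_span`,
`toClassGroup_restrict`, `toClassGroup_injective_one`, `card_ringClassGroup_mul`, `card_units_quot_span_natCast`,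
`finite_ringClassGroup`, `intCast_mem_span_iff`; Mathlib `Subgroup.card_mul_index`, `Subgroup.index_ker`,
`MonoidHom.range_eq_map`, `Subgroup.map_map`/`MonoidHom.map_range`, `Nat.totient_prime`.
`lean search 'card_ker_restrict|unitIndex|orderUnits'` → only `card_ker_restrict` (with `hunits`) and
`card_orderUnits_eq_two` (`2 ≤ f`).
-/

noncomputable section

open scoped nonZeroDivisors
open Module NumberField

namespace Literature.NumberTheory.QuadraticFields.RingClass

variable {K : Type*} [Field K] [NumberField K] {ℓ m : ℕ}
variable (b : Basis (Fin 2) ℤ (𝓞 K)) (hb : b 0 = 1) {t q : ℤ}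
  (hω : b 1 * b 1 = (q : 𝓞 K) + (t : 𝓞 K) * b 1)

omit [NumberField K] in
include hb in
/-- `(ℓm)𝓞 K ≠ 𝓞 K` for a prime `ℓ` and `m ≥ 1`. [cite: Cox2013, §7.C (the conductor ideal f𝒪_K)] -/
theorem span_natCast_mul_ne_top (hℓp : ℓ.Prime) (hm : m ≠ 0) :
    Ideal.span {((ℓ * m : ℕ) : 𝓞 K)} ≠ ⊤ := by
  intro htop
  have h1 : ((1 : ℤ) : 𝓞 K) ∈ Ideal.span {((ℓ * m : ℕ) : 𝓞 K)} := by
    rw [htop]; exact Submodule.mem_top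
  rw [intCast_mem_span_iff b hb] at h1
  have : ((ℓ * m : ℕ) : ℤ) ≤ 1 := Int.le_of_dvd one_pos h1
  have h2 : 2 ≤ ℓ * m := le_trans hℓp.two_le (Nat.le_mul_of_pos_right ℓ (Nat.pos_of_ne_zero hm))
  omega

include hb hω in
/-- **`#ker (I_K(ℓm)/P_{K,ℤ}(ℓm) → I_K(m)/P_{K,ℤ}(m)) ∣ ℓ² − 1 = #F_λ^×`** for ANY quadratic field `K`, `(ℓ)` prime in
`𝓞 K`, `gcd(ℓ, m) = 1`, `m ≥ 1`: the kernel is the image `θ_{ℓm}((𝓞 K/ℓ)ˣ × {1})` of the group `F_λ^×` of order `ℓ² − 1`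
(no hypothesis on the units).  Hence the EXPONENT side of Gross's «`G_ℓ ≃ F_λ^×/F_ℓ^×`»: every element of the
kernel has order dividing `q_λ − 1 = ℓ² − 1`.
[cite: GrossLMS1991, §3 (PDF p. 216–217)] [cite: Cox2013, §7.D (7.27)] -/
theorem card_ker_restrict_dvd_sq_sub_one (hcop : Nat.Coprime ℓ m) (hℓp : ℓ.Prime)
    (hinert : (Ideal.span {(ℓ : 𝓞 K)}).IsPrime) (hm : m ≠ 0) :
    Nat.card (restrict (K := K) (dvd_mul_left m ℓ)).ker ∣ ℓ ^ 2 - 1 := by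
  have hfn := span_natCast_mul_ne_top b hb hℓp hm
  set Θ := (theta K (ℓ * m) b hb hω hfn).comp (crtUnitHom hcop) with hΘ
  rw [ker_restrict_eq_range b hb hω hcop hfn, ← card_units_quot_span_natCast b hℓp.ne_zero hinert, ← hΘ,
    ← Subgroup.index_ker Θ]
  exact Dvd.intro_left _ (Subgroup.card_mul_index Θ.ker)

/-- For `(ℓ)` prime: `#(I_K(ℓm)/P_{K,ℤ}(ℓm)) = #ker · #(I_K(m)/P_{K,ℤ}(m))` (`restrict` is onto).
[cite: Cox2013, §7.C Prop. 7.20, Prop. 7.22] [cite: GrossLMS1991, §3 (PDF p. 216)] -/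
theorem card_ringClassGroup_eq_card_ker_mul (hcop : Nat.Coprime ℓ m) (hℓ : ℓ ≠ 0)
    (hinert : (Ideal.span {(ℓ : 𝓞 K)}).IsPrime) :
    Nat.card (RingClassGroup K (ℓ * m)) =
      Nat.card (restrict (K := K) (dvd_mul_left m ℓ)).ker * Nat.card (RingClassGroup K m) := by
  have hsurj := restrict_surjective_of_isPrime_span (K := K) hcop hℓ hinert (m := m)
  have h := Subgroup.card_mul_index (restrict (K := K) (dvd_mul_left m ℓ)).ker
  rw [Subgroup.index_ker, MonoidHom.range_eq_top.mpr hsurj, Subgroup.card_top] at h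
  exact h.symm

/-- For `(ℓ)` prime the image of `I_K(ℓ)/P_{K,ℤ}(ℓ)` in `Cl(𝓞 K)` has `#(I_K(1)/P_{K,ℤ}(1))` elements: it equals the
image of `I_K(1)/P_{K,ℤ}(1)` (`restrict` onto, `toClassGroup_restrict`), which embeds (`toClassGroup_injective_one`).
[cite: Cox2013, §7.C Prop. 7.22 (f = 1) and §7.D (7.25)] -/
theorem card_range_toClassGroup_eq_card_one (hℓ : ℓ ≠ 0) (hinert : (Ideal.span {(ℓ : 𝓞 K)}).IsPrime) :
    Nat.card (toClassGroup K (ℓ * 1)).range = Nat.card (RingClassGroup K 1) := by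
  have hsurj := restrict_surjective_of_isPrime_span (K := K) (Nat.coprime_one_right ℓ) hℓ hinert (m := 1)
  have hcomp : (toClassGroup K 1).comp (restrict (K := K) (dvd_mul_left 1 ℓ)) = toClassGroup K (ℓ * 1) :=
    MonoidHom.ext fun g => toClassGroup_restrict (dvd_mul_left 1 ℓ) g
  have hrange : (toClassGroup K (ℓ * 1)).range = (toClassGroup K 1).range := by
    rw [← hcomp, MonoidHom.range_comp, MonoidHom.range_eq_top.mpr hsurj, ← MonoidHom.range_eq_map]
  rw [hrange, Nat.card_congr (MonoidHom.ofInjective toClassGroup_injective_one).toEquiv.symm]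

include hb hω in
/-- **`#ker (I_K(ℓ)/P_{K,ℤ}(ℓ) → I_K(1)/P_{K,ℤ}(1)) · #𝓞_K^× = (ℓ + 1) · #𝒪_ℓ^×`** (`𝒪_ℓ^× = {ε ∈ 𝓞_K^× : ε ≡ n (mod ℓ),
n ∈ ℤ, gcd(n, ℓ) = 1}` the units of the order of conductor `ℓ`), for a quadratic field `K` and `(ℓ)` prime in
`𝓞 K`: Cox's Thm. 7.24 at `f = ℓ` — «`h(𝒪) = h(𝒪_K) f ∏ (1 − (d_K/p)/p) / [𝒪_K^× : 𝒪^×]`» with `(d_K/ℓ) = −1` — read on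
the counting identity `card_ringClassGroup_mul` (both sides are `0` for a real quadratic field).
[cite: Cox2013, §7.D Thm. 7.24 and (7.25)–(7.27)] [cite: GrossLMS1991, §3 (PDF p. 217 l. 1–3)] -/
theorem card_ker_restrict_mul_card_units_eq (hℓp : ℓ.Prime) (hinert : (Ideal.span {(ℓ : 𝓞 K)}).IsPrime) :
    Nat.card (restrict (K := K) (dvd_mul_left 1 ℓ)).ker * Nat.card (𝓞 K)ˣ =
      (ℓ + 1) * Nat.card {ε : (𝓞 K)ˣ // ∃ n : ℤ, IsCoprime n ((ℓ * 1 : ℕ) : ℤ) ∧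
        (ε : 𝓞 K) - n ∈ Ideal.span {((ℓ * 1 : ℕ) : 𝓞 K)}} := by
  have h2 : finrank ℚ K = 2 := by
    rw [← RingOfIntegers.rank K, finrank_eq_card_basis b, Fintype.card_fin]
  have hfn := span_natCast_mul_ne_top b hb hℓp one_ne_zero
  have hf0 : ℓ * 1 ≠ 0 := mul_ne_zero hℓp.ne_zero one_ne_zero
  haveI : Finite (RingClassGroup K 1) := finite_ringClassGroup h2 one_ne_zero
  have hR1 : 0 < Nat.card (RingClassGroup K 1) := Nat.card_pos
  have hid := card_ringClassGroup_mul b hb hω hfn hf0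
  rw [card_ringClassGroup_eq_card_ker_mul (Nat.coprime_one_right ℓ) hℓp.ne_zero hinert,
    card_range_toClassGroup_eq_card_one hℓp.ne_zero hinert,
    show Nat.totient (ℓ * 1) = ℓ - 1 by rw [Nat.mul_one, Nat.totient_prime hℓp],
    show Nat.card (𝓞 K ⧸ Ideal.span {((ℓ * 1 : ℕ) : 𝓞 K)})ˣ = ℓ ^ 2 - 1 by
      rw [Nat.mul_one]; exact card_units_quot_span_natCast b hℓp.ne_zero hinert] at hid
  have hℓ1 : 1 ≤ ℓ := hℓp.one_lt.le
  have hsq : ℓ ^ 2 - 1 = (ℓ + 1) * (ℓ - 1) := by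
    zify [hℓ1, Nat.one_le_pow 2 ℓ hℓp.pos]
    ring
  rw [hsq] at hid
  have hpos : 0 < Nat.card (RingClassGroup K 1) * (ℓ - 1) :=
    Nat.mul_pos hR1 (by have := hℓp.two_le; omega)
  apply Nat.eq_of_mul_eq_mul_right hpos
  calc Nat.card (restrict (K := K) (dvd_mul_left 1 ℓ)).ker * Nat.card (𝓞 K)ˣ *
        (Nat.card (RingClassGroup K 1) * (ℓ - 1))
      = Nat.card (restrict (K := K) (dvd_mul_left 1 ℓ)).ker * Nat.card (RingClassGroup K 1) *
          Nat.card (𝓞 K)ˣ * (ℓ - 1) := by ring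
    _ = (ℓ + 1) * (ℓ - 1) * Nat.card (RingClassGroup K 1) *
          Nat.card {ε : (𝓞 K)ˣ // ∃ n : ℤ, IsCoprime n ((ℓ * 1 : ℕ) : ℤ) ∧
            (ε : 𝓞 K) - n ∈ Ideal.span {((ℓ * 1 : ℕ) : 𝓞 K)}} := hid
    _ = _ := by ring

include hb hω in
/-- **`ℓ + 1 ∣ #ker (I_K(ℓ)/P_{K,ℤ}(ℓ) → I_K(1)/P_{K,ℤ}(1)) · #𝓞_K^×`**: the ORDER side of Gross's «`G_ℓ` of order
`ℓ + 1`» that survives for `d_K ∈ {−3, −4}` (`#G_ℓ = (ℓ+1)/[𝓞_K^× : 𝒪_ℓ^×]`).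
[cite: Cox2013, §7.D Thm. 7.24] [cite: GrossLMS1991, §1 (PDF p. 212), §3 (PDF p. 217 l. 1–3)] -/
theorem succ_dvd_card_ker_restrict_mul_card_units (hℓp : ℓ.Prime)
    (hinert : (Ideal.span {(ℓ : 𝓞 K)}).IsPrime) :
    ℓ + 1 ∣ Nat.card (restrict (K := K) (dvd_mul_left 1 ℓ)).ker * Nat.card (𝓞 K)ˣ :=
  Dvd.intro _ (card_ker_restrict_mul_card_units_eq b hb hω hℓp hinert).symm

end Literature.NumberTheory.QuadraticFields.RingClass

end
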